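import Literature.Analysis.FluidPDE.PeriodicLerayTransportGradient
import Literature.Analysis.FluidPDE.ForwardDSSLocalLerayEnergy
import Literature.Analysis.FluidPDE.CKNTenThirdsInterpolation
import Literature.Analysis.FluidPDE.LocalLerayCubicIntegrability
import HarnessLib

/-!
# [BT1] §4 ¶1–3, the transport of suitable periodic weak solutions, III: local integrability
  classes of a suitable periodic weak solution

Analysis/FluidPDE proof file (theorems only), third part of the discharge of the named fact
`Literature.Analysis.FluidPDE.bradshawTsai2017_ansatz_transport` (`PeriodicLeraySystem.lean`;
Bradshaw–Tsai, Ann. Henri Poincaré 18 (2017) = arXiv:1510.07504 [BT1], §4, proof of Thm 1.2).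

The local energy inequality of the tree's `IsSuitableWeakSolutionOn` (CKN (2.5)) and the one of
[BT1] Def. 2.3, (2.4), are single integrals of sums whose terms — after the change of variables
of §4 — match only up to the integrable term `∫∫ |u|²ψ` moved across the inequality; to move it
one needs the cubic and pressure terms `|u|²(u·∇ψ)`, `p (u·∇ψ)` to be integrable, i.e.
`u ∈ L³_loc`. For a suitable periodic weak solution `(u,p)` with profile `U₀` under Assumption 2.1
(`u − U₀ ∈ L^∞(L²) ∩ L²(0,T;H¹)`, `T`-periodic, `U₀ ∈ C¹`) this is the parabolic interpolation
`L^∞_t L²_x ∩ L²_t H¹_x ⊂ L^{10/3}_{t,x}` ([BT1] use it tacitly: "using `q = 10/3`",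
`‖U_ε‖_{L^{10/3}(ℝ³×[0,T])}`, proof of Thm 2.4), which the tree has **proved** on backward parabolic
cylinders (`exists_lintegral_tenThirds_backward_le`, `CKNTenThirdsInterpolation.lean`,
Lemarié-Rieusset 2016, (13.18)). This file derives, for such `(u, p)`:

* `u` is locally integrable and `|u|² ∈ L¹_loc(ℝ × ℝ³)` (`locallyIntegrable_norm_sq`);
* `∇u = G ∈ L²_loc(ℝ × ℝ³)` (`setLIntegral_frobeniusNormSq_lt_top_of_isCompact`; the a.e.
  periodicity of `∇(u − U₀)` of the sibling file and continuity of `DU₀`);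
* `A(r), E(r) < ∞` on every backward cylinder, hence `u ∈ L^{10/3}(Q_r(z))`
  (`setLIntegral_enorm_rpow_tenThirds_cylinder_lt_top`) and `u ∈ L^{10/3}_loc`, `u ∈ L³_loc`
  (`setLIntegral_enorm_pow_three_lt_top_of_isCompact`, `locallyIntegrable_norm_pow_three`);
* `|p| |u| ∈ L¹_loc` (`locallyIntegrable_abs_mul_norm`, Young with `3/2` and `3`).

## References

* Z. Bradshaw, T.-P. Tsai, Ann. Henri Poincaré 18 (2017) = arXiv:1510.07504, Def. 2.2–2.3, proof
  of Thm 2.4, §4 [BradshawTsai2017AHP].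
* P. G. Lemarié-Rieusset, *The Navier–Stokes problem in the 21st century* (2016), (13.17)–(13.18)
  [LemarieRieusset2016].
-/

noncomputable section

open MeasureTheory TopologicalSpace Set Function Filter Topology Module Metric
open scoped InnerProductSpace RealInnerProductSpace ENNReal NNReal

namespace Literature.Analysis.FluidPDE

namespace BradshawTsai2017

section Classes

variable {T : ℝ} {q : ℝ≥0∞}
  {U₀ u : ℝ → EuclideanSpace ℝ (Fin 3) → EuclideanSpace ℝ (Fin 3)}
  {p : ℝ → EuclideanSpace ℝ (Fin 3) → ℝ}

/-! ### Elementary inequalities -/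

/-- Young: `a b ≤ a^{3/2} + b³` in `[0, ∞]` (conjugate exponents `3/2`, `3`, constants dropped). [folklore] -/
theorem mul_le_rpow_threeHalves_add_pow_three (a b : ℝ≥0∞) :
    a * b ≤ a ^ (3 / 2 : ℝ) + b ^ (3 : ℕ) := by
  have hpq : (3 / 2 : ℝ).HolderConjugate 3 := Real.holderConjugate_iff.2 ⟨by norm_num, by norm_num⟩
  have h := ENNReal.young_inequality a b hpq
  have h1 : (1 : ℝ≥0∞) ≤ ENNReal.ofReal (3 / 2) := by
    rw [← ENNReal.ofReal_one]; exact ENNReal.ofReal_le_ofReal (by norm_num)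
  have h2 : (1 : ℝ≥0∞) ≤ ENNReal.ofReal 3 := by
    rw [← ENNReal.ofReal_one]; exact ENNReal.ofReal_le_ofReal (by norm_num)
  refine h.trans (add_le_add ?_ ?_)
  · exact ENNReal.div_le_of_le_mul (le_mul_of_one_le_right' h1)
  · rw [show (b ^ (3 : ℝ)) = b ^ (3 : ℕ) from (ENNReal.rpow_natCast b 3).symm ▸ by norm_num]
    exact ENNReal.div_le_of_le_mul (le_mul_of_one_le_right' h2)

/-- A compact set of space–time lies in a slab of bounded times. [folklore] -/
theorem exists_subset_Icc_prod_of_isCompact {X : Type*} [TopologicalSpace X] {K : Set (ℝ × X)}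
    (hK : IsCompact K) : ∃ a b : ℝ, K ⊆ Icc a b ×ˢ (univ : Set X) := by
  have h1 := hK.image continuous_fst
  obtain ⟨a, ha⟩ := h1.bddBelow
  obtain ⟨b, hb⟩ := h1.bddAbove
  exact ⟨a, b, fun z hz => ⟨⟨ha (mem_image_of_mem _ hz), hb (mem_image_of_mem _ hz)⟩, mem_univ _⟩⟩

/-- `‖ ‖a‖² ‖ₑ = ‖a‖ₑ²`. [folklore] -/
theorem enorm_norm_sq {F : Type*} [SeminormedAddCommGroup F] (a : F) : ‖‖a‖ ^ 2‖ₑ = ‖a‖ₑ ^ 2 := by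
  rw [Real.enorm_eq_ofReal (sq_nonneg _), ENNReal.ofReal_pow (norm_nonneg _), ofReal_norm]

/-- `‖ ‖a‖³ ‖ₑ = ‖a‖ₑ³`. [folklore] -/
theorem enorm_norm_pow_three {F : Type*} [SeminormedAddCommGroup F] (a : F) :
    ‖‖a‖ ^ 3‖ₑ = ‖a‖ₑ ^ 3 := by
  rw [Real.enorm_eq_ofReal (pow_nonneg (norm_nonneg _) 3), ENNReal.ofReal_pow (norm_nonneg _),
    ofReal_norm]

/-- Integrability on a compact set from a finite lower integral, for nonnegative real functions
given as norms. [folklore] -/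
theorem integrableOn_of_lintegral_enorm_lt_top {α : Type*} [MeasurableSpace α] {μ : Measure α}
    {f : α → ℝ} {K : Set α} (hf : AEStronglyMeasurable f μ)
    (hfin : ∫⁻ z in K, ‖f z‖ₑ ∂μ < ∞) : IntegrableOn f K μ :=
  ⟨hf.restrict, hfin⟩

/-! ### Local integrability of `u` and `|u|²` -/

/-- The velocity of a suitable periodic weak solution is locally integrable on `ℝ × ℝ³` (it has
a weak spatial gradient on `⊤`). [cite: BradshawTsai2017AHP, Def. 2.2] -/
theorem IsSuitablePeriodicWeakSolution.locallyIntegrable_uncurry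
    (hS : IsSuitablePeriodicWeakSolution T U₀ u p) : LocallyIntegrable (uncurry u) volume := by
  obtain ⟨G, hG, -, -, -⟩ := hS.weakForm
  exact locallyIntegrableOn_univ.1 (by simpa using hG.locallyIntegrableOn)

/-- **`u − U₀ ∈ L²((a,b] × ℝ³)`** on every bounded time window: Tonelli and the `L^∞(L²)` bound of
Definition 2.2 (holding for every `s`). [cite: BradshawTsai2017AHP, Def. 2.2] -/
theorem IsSuitablePeriodicWeakSolution.setLIntegral_enorm_sub_sq_lt_top
    (hS : IsSuitablePeriodicWeakSolution T U₀ u p) (hU : Continuous (uncurry U₀)) (a b : ℝ) :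
    ∫⁻ z in Ioc a b ×ˢ (univ : Set (EuclideanSpace ℝ (Fin 3))),
      ‖u z.1 z.2 - U₀ z.1 z.2‖ₑ ^ 2 < ∞ := by
  obtain ⟨C, hC⟩ := hS.energy
  have hmeas : AEMeasurable (fun z : ℝ × EuclideanSpace ℝ (Fin 3) => ‖u z.1 z.2 - U₀ z.1 z.2‖ₑ ^ 2)
      volume :=
    (hS.locallyIntegrable_uncurry.aestronglyMeasurable.sub hU.aestronglyMeasurable).enorm.pow_const 2
  rw [setLIntegral_Ioc_prod_univ_eq_lintegral_lintegral hmeas]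
  calc ∫⁻ s in Ioc a b, ∫⁻ y, ‖u s y - U₀ s y‖ₑ ^ 2
      ≤ ∫⁻ s in Ioc a b, (C : ℝ≥0∞) := setLIntegral_mono' measurableSet_Ioc fun s _ => hC s
    _ < ∞ := by
        rw [setLIntegral_const]
        exact ENNReal.mul_lt_top ENNReal.coe_lt_top (by simp [Real.volume_Ioc])

/-- `∫⁻_K |u|² < ∞` on compact sets (`|u|² ≤ 2|u − U₀|² + 2|U₀|²`, `U₀` continuous). [cite: BradshawTsai2017AHP, Def. 2.2] -/
theorem IsSuitablePeriodicWeakSolution.setLIntegral_enorm_sq_lt_top_of_isCompact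
    (hS : IsSuitablePeriodicWeakSolution T U₀ u p) (hU : Continuous (uncurry U₀))
    {K : Set (ℝ × EuclideanSpace ℝ (Fin 3))} (hK : IsCompact K) :
    ∫⁻ z in K, ‖uncurry u z‖ₑ ^ 2 < ∞ := by
  obtain ⟨a, b, hKab⟩ := exists_subset_Icc_prod_of_isCompact hK
  have hKab' : K ⊆ Ioc (a - 1) b ×ˢ (univ : Set (EuclideanSpace ℝ (Fin 3))) := fun z hz =>
    ⟨⟨by linarith [(hKab hz).1.1], (hKab hz).1.2⟩, mem_univ _⟩
  obtain ⟨M, hM⟩ := hK.exists_bound_of_continuousOn hU.continuousOn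
  calc ∫⁻ z in K, ‖uncurry u z‖ₑ ^ 2
      ≤ ∫⁻ z in K, (2 * ‖u z.1 z.2 - U₀ z.1 z.2‖ₑ ^ 2 + 2 * ENNReal.ofReal M ^ 2) := by
        refine setLIntegral_mono' hK.measurableSet fun z hz => ?_
        have e : uncurry u z = (u z.1 z.2 - U₀ z.1 z.2) + U₀ z.1 z.2 := (sub_add_cancel _ _).symm
        have : ‖U₀ z.1 z.2‖ₑ ≤ ENNReal.ofReal M := by
          rw [← ofReal_norm]
          exact ENNReal.ofReal_le_ofReal (hM z hz)
        rw [e]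
        refine (enorm_add_sq_le _ _).trans ?_
        gcongr
    _ = (2 * ∫⁻ z in K, ‖u z.1 z.2 - U₀ z.1 z.2‖ₑ ^ 2) + 2 * ENNReal.ofReal M ^ 2 * volume K := by
        rw [lintegral_add_right _ measurable_const, lintegral_const_mul' _ _ ENNReal.ofNat_ne_top,
          setLIntegral_const]
    _ < ∞ := by
        refine ENNReal.add_lt_top.2 ⟨ENNReal.mul_lt_top (by simp) ?_, ?_⟩
        · exact lt_of_le_of_lt (lintegral_mono_set hKab')
            (hS.setLIntegral_enorm_sub_sq_lt_top hU (a - 1) b)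
        · exact ENNReal.mul_lt_top (ENNReal.mul_lt_top (by simp)
            (ENNReal.pow_lt_top ENNReal.ofReal_lt_top)) hK.measure_lt_top

/-- **`|u|² ∈ L¹_loc(ℝ × ℝ³)`** for a suitable periodic weak solution with continuous profile. [cite: BradshawTsai2017AHP, Def. 2.2] -/
theorem IsSuitablePeriodicWeakSolution.locallyIntegrable_norm_sq
    (hS : IsSuitablePeriodicWeakSolution T U₀ u p) (hU : Continuous (uncurry U₀)) :
    LocallyIntegrable (fun z : ℝ × EuclideanSpace ℝ (Fin 3) => ‖uncurry u z‖ ^ 2) volume := by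
  have hum := hS.locallyIntegrable_uncurry.aestronglyMeasurable
  refine locallyIntegrable_iff.2 fun K hK => ?_
  refine integrableOn_of_lintegral_enorm_lt_top (hum.norm.pow 2) ?_
  simp_rw [enorm_norm_sq]
  exact hS.setLIntegral_enorm_sq_lt_top_of_isCompact hU hK

/-! ### `∇u ∈ L²_loc` -/

/-- **`∇u ∈ L²_loc(ℝ × ℝ³)`**: the weak gradient `G` of Definition 2.2 is square integrable on
compact sets (`G = ∇(u − U₀) + DU₀` with `∇(u − U₀) ∈ L²` over any bounded time window by the a.e.
periodicity of weak gradients, and `DU₀` continuous). [cite: BradshawTsai2017AHP, Def. 2.2] -/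
theorem setLIntegral_frobeniusNormSq_lt_top_of_isCompact (hT : 0 < T)
    (hA : ProfileAssumption T q U₀) (hS : IsSuitablePeriodicWeakSolution T U₀ u p)
    {G : ℝ → EuclideanSpace ℝ (Fin 3) → EuclideanSpace ℝ (Fin 3) →L[ℝ] EuclideanSpace ℝ (Fin 3)}
    (hG : HasWeakSpatialGradientOn (⊤ : Opens (ℝ × EuclideanSpace ℝ (Fin 3))) u G)
    (hGL2 : ∫⁻ z in Ioo 0 T ×ˢ (univ : Set (EuclideanSpace ℝ (Fin 3))),
      ENNReal.ofReal (frobeniusNormSq (G z.1 z.2 - fderiv ℝ (U₀ z.1) z.2)) < ∞)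
    {K : Set (ℝ × EuclideanSpace ℝ (Fin 3))} (hK : IsCompact K) :
    ∫⁻ z in K, ENNReal.ofReal (frobeniusNormSq (G z.1 z.2)) < ∞ := by
  -- the weak gradient `Gw = G − DU₀` of the periodic `w = u − U₀`
  set w : ℝ → EuclideanSpace ℝ (Fin 3) → EuclideanSpace ℝ (Fin 3) := fun s y => u s y - U₀ s y
    with hw
  set Gw : ℝ → EuclideanSpace ℝ (Fin 3) → EuclideanSpace ℝ (Fin 3) →L[ℝ] EuclideanSpace ℝ (Fin 3) :=
    fun s y => G s y - fderiv ℝ (U₀ s) y with hGw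
  have hGw' : HasWeakSpatialGradientOn (⊤ : Opens (ℝ × EuclideanSpace ℝ (Fin 3))) w Gw := by
    have h1 := hG.add (hasWeakSpatialGradientOn_neg_of_contDiff hA.contDiff)
    have e1 : (fun t x => u t x + -U₀ t x) = w := by
      funext t x; show u t x + -U₀ t x = u t x - U₀ t x; rw [sub_eq_add_neg]
    have e2 : (fun t x => G t x + -fderiv ℝ (U₀ t) x) = Gw := by
      funext t x; show G t x + -fderiv ℝ (U₀ t) x = G t x - fderiv ℝ (U₀ t) x; rw [sub_eq_add_neg]
    rwa [e1, e2] at h1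
  have hwper : ∀ s y, w (s + T) y = w s y := fun s y => by
    show u (s + T) y - U₀ (s + T) y = u s y - U₀ s y
    rw [hS.periodic, hA.periodic]
  have hper := ae_shift_invariant_of_weakGradient hGw' hwper
    (fun L => ENNReal.ofReal (frobeniusNormSq L))
  obtain ⟨a, b, hKab⟩ := exists_subset_Icc_prod_of_isCompact hK
  have hfinw : ∫⁻ z in K, ENNReal.ofReal (frobeniusNormSq (Gw z.1 z.2)) < ∞ :=
    setLIntegral_lt_top_of_ae_periodic_of_subset_Icc_prod hT hper (by simpa only [hGw] using hGL2)
      hKab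
  -- `DU₀` is bounded on `K`
  have hDU : Continuous fun z : ℝ × EuclideanSpace ℝ (Fin 3) =>
      frobeniusNormSq (fderiv ℝ (U₀ z.1) z.2) :=
    continuous_frobeniusNormSq'.comp (continuous_slice_fderiv_of_contDiff hA.contDiff)
  obtain ⟨M, hM⟩ := hK.exists_bound_of_continuousOn hDU.continuousOn
  calc ∫⁻ z in K, ENNReal.ofReal (frobeniusNormSq (G z.1 z.2))
      ≤ ∫⁻ z in K, (2 * ENNReal.ofReal (frobeniusNormSq (Gw z.1 z.2)) + 2 * ENNReal.ofReal M) := by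
        refine setLIntegral_mono' hK.measurableSet fun z hz => ?_
        have e : G z.1 z.2 = Gw z.1 z.2 + fderiv ℝ (U₀ z.1) z.2 := (sub_add_cancel _ _).symm
        rw [e]
        calc ENNReal.ofReal (frobeniusNormSq (Gw z.1 z.2 + fderiv ℝ (U₀ z.1) z.2))
            ≤ ENNReal.ofReal (2 * frobeniusNormSq (Gw z.1 z.2) +
                2 * frobeniusNormSq (fderiv ℝ (U₀ z.1) z.2)) :=
              ENNReal.ofReal_le_ofReal (frobeniusNormSq_add_le _ _)
          _ = 2 * ENNReal.ofReal (frobeniusNormSq (Gw z.1 z.2)) +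
                2 * ENNReal.ofReal (frobeniusNormSq (fderiv ℝ (U₀ z.1) z.2)) := by
              rw [ENNReal.ofReal_add (mul_nonneg zero_le_two (frobeniusNormSq_nonneg _))
                (mul_nonneg zero_le_two (frobeniusNormSq_nonneg _)),
                ENNReal.ofReal_mul zero_le_two, ENNReal.ofReal_mul zero_le_two, ENNReal.ofReal_ofNat]
          _ ≤ 2 * ENNReal.ofReal (frobeniusNormSq (Gw z.1 z.2)) + 2 * ENNReal.ofReal M := by
              have hMz : frobeniusNormSq (fderiv ℝ (U₀ z.1) z.2) ≤ M :=
                (le_abs_self _).trans ((Real.norm_eq_abs _).symm.le.trans (hM z hz))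
              gcongr
    _ = (2 * ∫⁻ z in K, ENNReal.ofReal (frobeniusNormSq (Gw z.1 z.2))) +
          2 * ENNReal.ofReal M * volume K := by
        rw [lintegral_add_right _ measurable_const, lintegral_const_mul' _ _ ENNReal.ofNat_ne_top,
          setLIntegral_const]
    _ < ∞ := by
        refine ENNReal.add_lt_top.2 ⟨ENNReal.mul_lt_top (by simp) hfinw, ?_⟩
        exact ENNReal.mul_lt_top (ENNReal.mul_lt_top (by simp) ENNReal.ofReal_lt_top) hK.measure_lt_top

/-! ### `u ∈ L^{10/3}_loc` and `u ∈ L³_loc` -/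

/-- **`u ∈ L^{10/3}(Q_r(z))` on every backward parabolic cylinder**: `A(r) < ∞` (slice energies
bounded for every `s`: `∫_{B}|u|² ≤ 2 sup_s ‖(u − U₀)(s)‖² + 2 |B| sup_K |U₀|²`) and `E(r) < ∞`
(`∇u ∈ L²_loc`), so the tree's parabolic interpolation `exists_lintegral_tenThirds_backward_le`
applies. [cite: BradshawTsai2017AHP, proof of Thm 2.4 ("using q = 10/3")] -/
theorem setLIntegral_enorm_rpow_tenThirds_cylinder_lt_top (hT : 0 < T)
    (hA : ProfileAssumption T q U₀) (hS : IsSuitablePeriodicWeakSolution T U₀ u p)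
    (z₀ : ℝ × EuclideanSpace ℝ (Fin 3)) {r : ℝ} (hr : 0 < r) :
    ∫⁻ z in parabolicCylinder r z₀, ‖u z.1 z.2‖ₑ ^ (10 / 3 : ℝ) < ∞ := by
  obtain ⟨G, hG, hGL2, -, -⟩ := hS.weakForm
  obtain ⟨K, hK⟩ := exists_lintegral_tenThirds_backward_le
  have hU : Continuous (uncurry U₀) := hA.contDiff.continuous
  -- the closed room around the cylinder
  set R : Set (ℝ × EuclideanSpace ℝ (Fin 3)) := Icc (z₀.1 - r ^ 2) z₀.1 ×ˢ closedBall z₀.2 r with hR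
  have hRc : IsCompact R := isCompact_Icc.prod (isCompact_closedBall _ _)
  have hQR : parabolicCylinder r z₀ ⊆ R :=
    prod_mono Ioo_subset_Icc_self ball_subset_closedBall
  -- `A(r) < ∞`
  obtain ⟨C, hC⟩ := hS.energy
  obtain ⟨M, hM⟩ := hRc.exists_bound_of_continuousOn hU.continuousOn
  have hslice : ∀ t ∈ Ioo (z₀.1 - r ^ 2) z₀.1,
      ∫⁻ x in ball z₀.2 r, ‖u t x‖ₑ ^ 2 ≤ 2 * C + 2 * ENNReal.ofReal M ^ 2 * volume (ball z₀.2 r) := by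
    intro t ht
    calc ∫⁻ x in ball z₀.2 r, ‖u t x‖ₑ ^ 2
        ≤ ∫⁻ x in ball z₀.2 r, (2 * ‖u t x - U₀ t x‖ₑ ^ 2 + 2 * ENNReal.ofReal M ^ 2) := by
          refine setLIntegral_mono' measurableSet_ball fun x hx => ?_
          have e : u t x = (u t x - U₀ t x) + U₀ t x := (sub_add_cancel _ _).symm
          have : ‖U₀ t x‖ₑ ≤ ENNReal.ofReal M := by
            rw [← ofReal_norm]
            exact ENNReal.ofReal_le_ofReal (hM (t, x) ⟨Ioo_subset_Icc_self ht, ball_subset_closedBall hx⟩)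
          calc ‖u t x‖ₑ ^ 2 = ‖(u t x - U₀ t x) + U₀ t x‖ₑ ^ 2 := by rw [sub_add_cancel]
            _ ≤ 2 * ‖u t x - U₀ t x‖ₑ ^ 2 + 2 * ‖U₀ t x‖ₑ ^ 2 := enorm_add_sq_le _ _
            _ ≤ 2 * ‖u t x - U₀ t x‖ₑ ^ 2 + 2 * ENNReal.ofReal M ^ 2 := by gcongr
      _ = (2 * ∫⁻ x in ball z₀.2 r, ‖u t x - U₀ t x‖ₑ ^ 2) +
            2 * ENNReal.ofReal M ^ 2 * volume (ball z₀.2 r) := by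
          rw [lintegral_add_right _ measurable_const, lintegral_const_mul' _ _ ENNReal.ofNat_ne_top,
            setLIntegral_const]
      _ ≤ 2 * C + 2 * ENNReal.ofReal M ^ 2 * volume (ball z₀.2 r) := by
          have : ∫⁻ x in ball z₀.2 r, ‖u t x - U₀ t x‖ₑ ^ 2 ≤ C :=
            (setLIntegral_le_lintegral _ _).trans (hC t)
          gcongr
  have hbound : FluidPDE.cknA r z₀ u ≤
      (ENNReal.ofReal r)⁻¹ * (2 * C + 2 * ENNReal.ofReal M ^ 2 * volume (ball z₀.2 r)) :=
    iSup₂_le fun t ht => mul_le_mul' le_rfl (hslice t ht)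
  have hbound' : (ENNReal.ofReal r)⁻¹ * (2 * C + 2 * ENNReal.ofReal M ^ 2 * volume (ball z₀.2 r)) ≠ ∞ := by
    refine ENNReal.mul_ne_top (ENNReal.inv_ne_top.2 (by simpa using hr)) ?_
    refine ENNReal.add_ne_top.2 ⟨ENNReal.mul_ne_top (by simp) ENNReal.coe_ne_top, ?_⟩
    exact ENNReal.mul_ne_top (ENNReal.mul_ne_top (by simp) (ENNReal.pow_ne_top ENNReal.ofReal_ne_top))
      measure_ball_lt_top.ne
  have hAfin : cknAEss r z₀ u ≠ ∞ :=
    ne_top_of_le_ne_top hbound' (cknAEss_le_cknA.trans hbound)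
  -- `E(r) < ∞`
  have hEfin : cknE r z₀ G ≠ ∞ := by
    refine ENNReal.mul_ne_top (ENNReal.inv_ne_top.2 (by simpa using hr)) ?_
    exact (lt_of_le_of_lt (lintegral_mono_set hQR)
      (setLIntegral_frobeniusNormSq_lt_top_of_isCompact hT hA hS hG hGL2 hRc)).ne
  have key := hK u G z₀ r hr (hG.mono le_top) hAfin hEfin
  refine lt_of_le_of_lt key ?_
  refine ENNReal.mul_lt_top (ENNReal.mul_lt_top (ENNReal.mul_lt_top ENNReal.coe_lt_top
    ENNReal.ofReal_lt_top) ?_) ?_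
  · exact ENNReal.rpow_lt_top_of_nonneg (by norm_num) hAfin
  · exact ENNReal.add_lt_top.2 ⟨lt_top_iff_ne_top.2 hAfin, lt_top_iff_ne_top.2 hEfin⟩

/-- Every compact subset of `ℝ × ℝ³` lies in a backward parabolic cylinder. [folklore] -/
theorem exists_subset_parabolicCylinder_of_isCompact {K : Set (ℝ × EuclideanSpace ℝ (Fin 3))}
    (hK : IsCompact K) :
    ∃ (r : ℝ) (z₀ : ℝ × EuclideanSpace ℝ (Fin 3)), 0 < r ∧ K ⊆ parabolicCylinder r z₀ := by
  obtain ⟨a, b, hKab⟩ := exists_subset_Icc_prod_of_isCompact hK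
  obtain ⟨ρ, hρ⟩ := (hK.image continuous_snd).isBounded.subset_closedBall (0 : EuclideanSpace ℝ (Fin 3))
  set r : ℝ := |a| + |b| + |ρ| + 2 with hr
  have hr1 : 1 ≤ r := by rw [hr]; linarith [abs_nonneg a, abs_nonneg b, abs_nonneg ρ]
  have hr0 : 0 < r := lt_of_lt_of_le zero_lt_one hr1
  refine ⟨r, (b + 1, 0), hr0, fun z hz => ?_⟩
  have h1 := hKab hz
  have h2 : z.2 ∈ closedBall (0 : EuclideanSpace ℝ (Fin 3)) ρ := hρ (mem_image_of_mem _ hz)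
  rw [mem_closedBall, dist_zero_right] at h2
  refine mem_parabolicCylinder.2 ⟨⟨?_, ?_⟩, ?_⟩
  · have hsq : r ≤ r ^ 2 := by nlinarith
    have : b - a + 2 ≤ r := by
      rw [hr]; linarith [le_abs_self a, neg_abs_le a, le_abs_self b, abs_nonneg ρ]
    simp only
    linarith [h1.1.1]
  · simp only; linarith [h1.1.2]
  · rw [dist_zero_right]
    calc ‖z.2‖ ≤ ρ := h2
      _ ≤ |ρ| := le_abs_self ρ
      _ < r := by rw [hr]; linarith [abs_nonneg a, abs_nonneg b]

/-- **`u ∈ L^{10/3}_loc`**: `∫⁻_K |u|^{10/3} < ∞` for every compact `K`. [cite: BradshawTsai2017AHP, proof of Thm 2.4 ("using q = 10/3")] -/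
theorem setLIntegral_enorm_rpow_tenThirds_lt_top_of_isCompact (hT : 0 < T)
    (hA : ProfileAssumption T q U₀) (hS : IsSuitablePeriodicWeakSolution T U₀ u p)
    {K : Set (ℝ × EuclideanSpace ℝ (Fin 3))} (hK : IsCompact K) :
    ∫⁻ z in K, ‖u z.1 z.2‖ₑ ^ (10 / 3 : ℝ) < ∞ := by
  obtain ⟨r, z₀, hr, hKQ⟩ := exists_subset_parabolicCylinder_of_isCompact hK
  exact lt_of_le_of_lt (lintegral_mono_set hKQ)
    (setLIntegral_enorm_rpow_tenThirds_cylinder_lt_top hT hA hS z₀ hr)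

/-- **`u ∈ L³_loc`**: `∫⁻_K |u|³ < ∞` for every compact `K` (`|u|³ ≤ 1 + |u|^{10/3}`). [folklore] -/
theorem setLIntegral_enorm_pow_three_lt_top_of_isCompact (hT : 0 < T)
    (hA : ProfileAssumption T q U₀) (hS : IsSuitablePeriodicWeakSolution T U₀ u p)
    {K : Set (ℝ × EuclideanSpace ℝ (Fin 3))} (hK : IsCompact K) :
    ∫⁻ z in K, ‖u z.1 z.2‖ₑ ^ (3 : ℕ) < ∞ := by
  calc ∫⁻ z in K, ‖u z.1 z.2‖ₑ ^ (3 : ℕ)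
      ≤ ∫⁻ z in K, (1 + ‖u z.1 z.2‖ₑ ^ (10 / 3 : ℝ)) :=
        lintegral_mono fun z => IsLocalLeraySolution.pow_three_le_one_add_rpow _
    _ = volume K + ∫⁻ z in K, ‖u z.1 z.2‖ₑ ^ (10 / 3 : ℝ) := by
        rw [lintegral_add_left measurable_const, setLIntegral_const, one_mul]
    _ < ∞ := ENNReal.add_lt_top.2 ⟨hK.measure_lt_top,
        setLIntegral_enorm_rpow_tenThirds_lt_top_of_isCompact hT hA hS hK⟩

/-- **`|u|³ ∈ L¹_loc(ℝ × ℝ³)`**. [folklore] -/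
theorem locallyIntegrable_norm_pow_three (hT : 0 < T) (hA : ProfileAssumption T q U₀)
    (hS : IsSuitablePeriodicWeakSolution T U₀ u p) :
    LocallyIntegrable (fun z : ℝ × EuclideanSpace ℝ (Fin 3) => ‖uncurry u z‖ ^ 3) volume := by
  have hum := hS.locallyIntegrable_uncurry.aestronglyMeasurable
  refine locallyIntegrable_iff.2 fun K hK => ?_
  refine integrableOn_of_lintegral_enorm_lt_top (hum.norm.pow 3) ?_
  simp_rw [enorm_norm_pow_three]
  exact setLIntegral_enorm_pow_three_lt_top_of_isCompact hT hA hS hK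

/-- **`|p| |u| ∈ L¹_loc(ℝ × ℝ³)`** (`p ∈ L^{3/2}_loc`, `u ∈ L³_loc`, Young). [folklore] -/
theorem locallyIntegrable_abs_mul_norm (hT : 0 < T) (hA : ProfileAssumption T q U₀)
    (hS : IsSuitablePeriodicWeakSolution T U₀ u p) :
    LocallyIntegrable (fun z : ℝ × EuclideanSpace ℝ (Fin 3) => |uncurry p z| * ‖uncurry u z‖)
      volume := by
  have hum := hS.locallyIntegrable_uncurry.aestronglyMeasurable
  have hpm := hS.locallyIntegrable_pressure.aestronglyMeasurable
  refine locallyIntegrable_iff.2 fun K hK => ?_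
  have hmeas : AEStronglyMeasurable
      (fun z : ℝ × EuclideanSpace ℝ (Fin 3) => |uncurry p z| * ‖uncurry u z‖) volume :=
    (hpm.norm.mul hum.norm).congr (Eventually.of_forall fun z => by simp [Real.norm_eq_abs])
  refine integrableOn_of_lintegral_enorm_lt_top hmeas ?_
  have e : ∀ z : ℝ × EuclideanSpace ℝ (Fin 3),
      ‖|uncurry p z| * ‖uncurry u z‖‖ₑ = ‖uncurry p z‖ₑ * ‖uncurry u z‖ₑ := fun z => by
    rw [enorm_mul, Real.enorm_abs, enorm_norm]
  simp_rw [e]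
  calc ∫⁻ z in K, ‖uncurry p z‖ₑ * ‖uncurry u z‖ₑ
      ≤ ∫⁻ z in K, (‖uncurry p z‖ₑ ^ (3 / 2 : ℝ) + ‖uncurry u z‖ₑ ^ (3 : ℕ)) :=
        lintegral_mono fun z => mul_le_rpow_threeHalves_add_pow_three _ _
    _ = (∫⁻ z in K, ‖uncurry p z‖ₑ ^ (3 / 2 : ℝ)) + ∫⁻ z in K, ‖uncurry u z‖ₑ ^ (3 : ℕ) :=
        lintegral_add_left' (hpm.aemeasurable.enorm.pow_const _).restrict _
    _ < ∞ := ENNReal.add_lt_top.2 ⟨hS.pressure_threeHalves K hK,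
        setLIntegral_enorm_pow_three_lt_top_of_isCompact hT hA hS hK⟩

end Classes

end BradshawTsai2017

end Literature.Analysis.FluidPDE

end
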